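/-
Copyright (c) 2026 the pub-hodgecm-mathlib formalisation cell (harness21).  Prover seat hodgecm-mathlib-F0P3b-p01 (g13): «S3-ram» seeding wave (LEAD F0P3a-plan (g12)
T11-41; owner F0P3a-p06 (g15)), row «P-1-ram (i) (N1) RAMIFIED LITERALS»; 2026-09-01.
-/
import Literature.NumberTheory.Rogawski1990.UnitFundamentalLemmaFrameOfFormCongr          -- ★ p846897 (p04 (g17)): the one-place frame `e` from the fold binders `(hH′w) (A hA hframe)`
import Literature.NumberTheory.Automorphic.UnitaryThreeUnipotentClassesRamifiedPlace        -- ★ p846845 (p08 (g18)): `exists_fixed_unit_norm_dichotomy_of_ramified_complexConj` (the non-norm unit `ε`)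
import Literature.NumberTheory.Rogawski1990.LocalStableClassesNonsplit                      -- ★ B-p04: frame algebra `conj_eq_diagonal_of_commute`
import Literature.NumberTheory.Automorphic.UnitaryDiagonalUnitFormsIntegralFramesRamified    -- ★ p846940 (p08 (g19), split (a) of this row): `exists_glInt_formCongr_antidiagonal_eq_diagonal_units_adicCompletion`
import HarnessLib

/-!
# The four matched representatives of a type-(1) stable class at a TAME-RAMIFIED place: frame transports of `diag(α, u, γ)` along integral
# isometries `ᵗσ̄P · J₀ · P = diag(ε^b₀, ε^b₁, −ε^(b₀+b₁))` (Rogawski 1990 §3.5–3.6, §4.9; Flicker 1998 §2)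

Topic `NumberTheory/Rogawski1990`; namespace `Literature.NumberTheory.Rogawski1990`.  KERNEL mathematics only: theorems, no definition, no named fact, no instance,
no notation, no `sorry`.  Cell `pub/hodgecm-mathlib`, crux H413 (`--supports stmt-HodgeConjecture-24833`), road «S3-res» ∕ «S3-ram» seeding wave (LEAD T11-41, owner
F0P3a-p06 (g15)), row **«P-1-ram (i) (N1) RAMIFIED LITERALS»** (left open by p04 (g17), census 21:48:58Z; consumer: A-p16 (g31)'s «P-1-ram» skeleton STUB A′ (i)).
HONEST LABEL: HC_CM is proved only modulo the 2 remaining named inputs (hLiu418 24832, h413 24833) until rung 0 closes; this file has no books consequence.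

THE MATHEMATICS.  `L ∕ L⁺` CM, `v` a finite place of `L⁺`, `w ∣ v` non-split (`c • w = w`), `σ = σ_w`, `J₀ = antidiag(1,1,1)` on `L_w³`.  A type-(1) regular element
`X ∈ GL₃(L_w)` (eigenframe `X · P_X = P_X · diag(x)`, `x` injective, `σ(xᵢ)xᵢ = 1`) meets `U(σ, J₀)` in a STABLE class which is the union of the `U(σ, J₀)`-classes
indexed by the norm classes of the `J₀`-lengths of the three eigenlines [Rogawski1990, §3.5 Prop. 3.5.2, §3.6].  At an INERT `w` Flicker's closed-form literals
`t₁, t_π, t₃, t₄` represent the four classes; at a RAMIFIED `w` they do not (their eigenline lengths `(2, 1, −2)`, `(2π, 1, −2π)`, … collide modulo squares of the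
residue field when `χ(2) ≠ χ(−2)`).  The representatives that work at every non-split place are FRAME TRANSPORTS: for an isometry datum `ᵗσ̄P · J₀ · P = diag(D)`
(`D` σ-fixed) the literal `τ = P · diag(x) · P⁻¹` lies in `U(σ, J₀)` (§1 `conj_diagonal_mem_unitaryGroupOfForm_of_formCongr_eq_diagonal`), has eigenframe `P`
(`conj_diagonal_mul_frame`), is conjugate to `X` in `GL₃` (`isConj_conj_diagonal_of_frame`), and two such literals `τ, τ′` (data `(P, D)`, `(P′, D′)`) are
`U(σ, J₀)`-conjugate ONLY IF every ratio `Dᵢ ∕ D′ᵢ` is a norm `σ(m)·m` (§1 `forall_exists_norm_mul_of_conj_eq` — the centraliser of `diag(x)` is diagonal).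
§2 dresses this at a CM place in the frame `e : G′_v ≃ₜ* U(σ_w, J₀)(L_w)` of ★ `exists_frame_of_eq_smul_formCongr_antidiagonal` (p04): given integral isometries
`P b₀ b₁ ∈ GL₃(𝒪_w)` onto `D_b = diag(ε^b₀, ε^b₁, −ε^(b₀+b₁))` with `ε` a σ-fixed unit which is NOT a norm (★ `exists_fixed_unit_norm_dichotomy_of_ramified_complexConj`
at a tame-ramified `w`; the integral isometries are ★ `HermitianUnimodularRamified.exists_formCongr_eq_of_det_eq_mul_norm_three` ∕ p08 (g19)'s valued twin), the
four elements `t b₀ b₁ := e⁻¹(P_b · diag(x) · P_b⁻¹) ∈ G′_v` are in the level `K′` (★ frame clause (ii)), match every `γ_H` whose one-place image has eigenframe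
for `diag(x)` (★ frame clause (iii)), carry the literal∕eigenframe identities the lattice counts consume, and are PAIRWISE NON-CONJUGATE in `G′_v`
(**`forall_ramified_representatives_of_frames`**); the slot-`1` length `ε^b₁` is the κ-sign slot of [Rogawski1990, (4.3.2)] (★ `finKappaAt_eq_ite_twistGram_mul_eigenframe`).

## References
* [Rogawski1990] J. D. Rogawski, *Automorphic Representations of Unitary Groups in Three Variables*, Ann. of Math. Stud. 123 (1990), §3.5 Prop. 3.5.2 p. 29, §3.6 p. 31,
  §4.3 (4.3.2) p. 43, §4.9 p. 54, §14.2 p. 233.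
* [Flicker1998UnitaryFL] Y. Z. Flicker, *Elementary proof of the fundamental lemma for a unitary group*, Canad. J. Math. 50 (1998), §2 Prop. 3 pp. 78–79.
* [Jacobowitz1962] R. Jacobowitz, *Hermitian forms over local fields*, Amer. J. Math. 84 (1962), §8.  [LabesseLanglands1979] §2 pp. 8–9.
-/

set_option autoImplicit false

noncomputable section

open NumberField IsDedekindDomain Matrix Topology
open scoped Matrix MatrixGroups

namespace Literature.NumberTheory.Rogawski1990

open Literature.NumberTheory.Automorphic Literature.NumberTheory.Automorphic.UnitaryGroup

/-! ## §1 Frame transports of a diagonal torus element (any field with an endomorphism `σ`) -/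

section Generic

variable {K : Type*} [Field K] (σ : K →+* K)

/-- A diagonal matrix of `σ`-norm-one entries preserves every DIAGONAL form: `ᵗσ̄(diag x) · diag(D) · diag(x) = diag(σ(xᵢ) Dᵢ xᵢ) = diag(D)`.
[cite: Rogawski1990, §3.6 p. 31] -/
theorem diagonal_mem_unitaryGroupOfForm_diagonal {d : GL (Fin 3) K} {x : Fin 3 → K} (hd : d.val = diagonal x) (hx1 : ∀ i, σ (x i) * x i = 1)
    (D : Fin 3 → K) : d ∈ unitaryGroupOfForm σ (diagonal D) := by
  rw [mem_unitaryGroupOfForm_iff, show (d : Matrix (Fin 3) (Fin 3) K) = diagonal x from hd, diagonal_map (map_zero σ), diagonal_transpose,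
    diagonal_mul_diagonal, diagonal_mul_diagonal]
  congr 1
  funext i
  rw [mul_comm (σ (x i)) (D i), mul_assoc, hx1 i, mul_one]

/-- **THE LITERAL IS UNITARY**: if `ᵗσ̄P · J · P = diag(D)` then `P · diag(x) · P⁻¹ ∈ U(σ, J)` for `σ(xᵢ) xᵢ = 1` (★ `conj_mem_unitaryGroupOfForm`).
[cite: Rogawski1990, §3.6 p. 31] [cite: Flicker1998UnitaryFL, §2 Prop. 3 p. 78] -/
theorem conj_diagonal_mem_unitaryGroupOfForm_of_formCongr_eq_diagonal {J : Matrix (Fin 3) (Fin 3) K} {P d : GL (Fin 3) K} {D x : Fin 3 → K}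
    (hPD : formCongr σ P J = diagonal D) (hd : d.val = diagonal x) (hx1 : ∀ i, σ (x i) * x i = 1) :
    P * d * P⁻¹ ∈ unitaryGroupOfForm σ J :=
  conj_mem_unitaryGroupOfForm σ P J (hPD ▸ diagonal_mem_unitaryGroupOfForm_diagonal σ hd hx1 D)

omit σ in
/-- **THE LITERAL'S EIGENFRAME IS `P`**: `(P · diag(x) · P⁻¹) · P = P · diag(x)`. [cite: Rogawski1990, §3.5 p. 29] -/
theorem conj_diagonal_mul_frame {P d : GL (Fin 3) K} {x : Fin 3 → K} (hd : d.val = diagonal x) :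
    (P * d * P⁻¹).val * P.val = P.val * diagonal x := by
  rw [Units.val_mul, Units.val_mul, Matrix.mul_assoc, Matrix.mul_assoc, ← Units.val_mul, inv_mul_cancel, Units.val_one, Matrix.mul_one, hd]

omit σ in
/-- **THE LITERAL IS STABLY CONJUGATE TO EVERY `X` WITH AN EIGENFRAME FOR THE SAME DIAGONAL** (★ `isConj_of_mul_frame_eq`): `X · Q = Q · diag(x)` ⇒
`X ∼ P · diag(x) · P⁻¹` in `GL₃(K)`. [cite: Rogawski1990, §3.1 p. 19] -/
theorem isConj_conj_diagonal_of_frame {X Q P d : GL (Fin 3) K} {x : Fin 3 → K} (hX : X.val * Q.val = Q.val * diagonal x) (hd : d.val = diagonal x) :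
    IsConj X (P * d * P⁻¹) := by
  have hXQ : X * Q = Q * d := Units.ext (by rw [Units.val_mul, Units.val_mul, hd]; exact hX)
  refine isConj_iff.2 ⟨P * Q⁻¹, ?_⟩
  calc P * Q⁻¹ * X * (P * Q⁻¹)⁻¹ = P * Q⁻¹ * (X * Q) * P⁻¹ := by group
    _ = P * d * P⁻¹ := by rw [hXQ]; group

/-- **CONJUGATE LITERALS HAVE NORM-EQUIVALENT LENGTH DATA.**  If `ᵗσ̄P J P = diag(D)`, `ᵗσ̄P′ J P′ = diag(D′)`, `x` is injective and some `k ∈ U(σ, J)` conjugates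
`P · diag(x) · P⁻¹` to `P′ · diag(x) · P′⁻¹`, then every ratio `Dᵢ ∕ D′ᵢ` is a norm: `Dᵢ = σ(mᵢ) mᵢ D′ᵢ` with `mᵢ ≠ 0` — indeed `M = P′⁻¹ k P` commutes with
`diag(x)`, so it is diagonal (★ `conj_eq_diagonal_of_commute`), and `ᵗσ̄M · diag(D′) · M = ᵗσ̄P (ᵗσ̄k J k) P = diag(D)`.  (The class invariant of
[Rogawski1990, §3.5 Prop. 3.5.2 (c)]: eigenline lengths modulo norms.) [cite: Rogawski1990, §3.5 Prop. 3.5.2 pp. 29–30; §3.6 p. 31] -/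
theorem forall_exists_norm_mul_of_conj_eq {J : Matrix (Fin 3) (Fin 3) K} {P P' d k : GL (Fin 3) K} {D D' x : Fin 3 → K}
    (hPD : formCongr σ P J = diagonal D) (hP'D' : formCongr σ P' J = diagonal D') (hd : d.val = diagonal x) (hx : Function.Injective x)
    (hk : k ∈ unitaryGroupOfForm σ J) (hconj : k * (P * d * P⁻¹) * k⁻¹ = P' * d * P'⁻¹) :
    ∀ i, ∃ m : K, m ≠ 0 ∧ D i = σ m * m * D' i := by
  -- `M = P′⁻¹ k P` commutes with `diag(x)`
  set M : GL (Fin 3) K := P'⁻¹ * k * P with hM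
  have hMd : M * d = d * M := by
    have h1 : k * (P * d * P⁻¹) = P' * d * P'⁻¹ * k := by rw [← hconj]; group
    calc M * d = P'⁻¹ * (k * (P * d * P⁻¹)) * P := by rw [hM]; group
      _ = P'⁻¹ * (P' * d * P'⁻¹ * k) * P := by rw [h1]
      _ = d * M := by rw [hM]; group
  have hcomm : Commute M.val (diagonal x) := by
    have h := congrArg (fun g : GL (Fin 3) K => g.val) hMd
    simp only [Units.val_mul, hd] at h
    exact h
  -- hence `M` is diagonal
  have hframe1 : diagonal x * (1 : GL (Fin 3) K).val = (1 : GL (Fin 3) K).val * diagonal x := by rw [Units.val_one, Matrix.mul_one, Matrix.one_mul]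
  have hdiag := conj_eq_diagonal_of_commute hframe1 hx hcomm
  rw [inv_one, Units.val_one, Matrix.one_mul, Matrix.mul_one] at hdiag
  -- `ᵗσ̄M · diag(D′) · M = diag(D)`
  have hkP : k * P = P' * M := by rw [hM]; group
  have hform : formCongr σ M (diagonal D') = diagonal D := by
    have h1 : formCongr σ (k * P) J = diagonal D := by
      rw [show formCongr σ (k * P) J = formCongr σ P (formCongr σ k J) from ?_, show formCongr σ k J = J from hk, hPD]
      simp only [formCongr, Units.val_mul, Matrix.map_mul, Matrix.transpose_mul, Matrix.mul_assoc]
    have h2 : formCongr σ (P' * M) J = formCongr σ M (diagonal D') := by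
      rw [← hP'D']
      simp only [formCongr, Units.val_mul, Matrix.map_mul, Matrix.transpose_mul, Matrix.mul_assoc]
    rw [← h2, ← hkP, h1]
  -- read the diagonal entries
  intro i
  have hMi : M.val = diagonal fun j => M.val j j := hdiag
  have hii := congrFun (congrFun hform i) i
  rw [show formCongr σ M (diagonal D') = ((M.val).map σ)ᵀ * diagonal D' * M.val from rfl, hMi, diagonal_map (map_zero σ), diagonal_transpose,
    diagonal_mul_diagonal, diagonal_mul_diagonal, diagonal_apply_eq, diagonal_apply_eq] at hii
  refine ⟨M.val i i, fun h0 => ?_, ?_⟩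
  · -- a diagonal invertible matrix has non-zero diagonal entries
    have hdet : M.val.det ≠ 0 := (Matrix.isUnits_det_units M).ne_zero
    rw [hMi, det_diagonal] at hdet
    exact hdet (Finset.prod_eq_zero (Finset.mem_univ i) h0)
  · rw [← hii]; ring

end Generic

/-! ## §2 The four representatives in `G′_v = U(H′)(L⁺_v)` at a non-split place (CM carriers, one-place frame of ★ p846897) -/

section CM

variable (L : Type) [Field L] [NumberField L] [IsCMField L] (H' : Matrix (Fin 3) (Fin 3) L)
  {v : HeightOneSpectrum (𝓞 ↥(maximalRealSubfield L))}

/-- Norm one forces valuation one: `σ_w(a) a = 1 ⇒ |a|_w = 1` (`σ_w` is isometric). [cite: CasselsFrohlichANT1967, Ch. VII §1.1] -/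
theorem valuation_eq_one_of_galAdicCompletionMap_mul_self_eq_one (w : PlacesOver L v) (hw : IsCMField.complexConj L • w.1 = w.1)
    {a : w.1.adicCompletion L} (ha : galAdicCompletionMap (L := L) (IsCMField.complexConj L) hw a * a = 1) :
    ValuativeRel.valuation (w.1.adicCompletion L) a = 1 := by
  have h := congrArg (ValuativeRel.valuation (w.1.adicCompletion L)) ha
  rw [map_mul, map_one, valuation_galAdicCompletionMap_eq (IsCMField.complexConj L) v w hw, ← sq] at h
  exact (pow_eq_one_iff.1 h).resolve_right two_ne_zero

set_option maxHeartbeats 400000 in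
/-- **THE FOUR RAMIFIED REPRESENTATIVES FROM INTEGRAL ISOMETRY DATA.**  `v` a finite place of `L⁺` non-split in `L` (`c • w = w`; ramified allowed), `H′_w`
framed by the fold's binders `(hH′w) (A hA hframe)` (★ `exists_glInt_placeForm_eq_smul_formCongr_antidiagonal_of_neg` at a tame-ramified `w`), `ε ∈ L_w` NOT a norm
`t σ_w(t)` (★ `exists_fixed_unit_norm_dichotomy_of_ramified_complexConj`), and for each `b = (b₀, b₁) ∈ (Fin 2)²` an INTEGRAL ISOMETRY `P_b ∈ GL₃(𝒪_w)`,
`ᵗσ̄_w(P_b) · J₀ · P_b = D_b := diag(ε^b₀, ε^b₁, −ε^(b₀+b₁))` (★ `HermitianUnimodularRamified.exists_formCongr_eq_of_det_eq_mul_norm_three`: `det D_b = det J₀ · N(ε^(b₀+b₁))`).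
Then for every torus datum `x : Fin 3 → L_w` (pairwise distinct, `σ_w(xᵢ) xᵢ = 1`) there are the one-place frame `e : G′_v ≃ₜ* U(σ_w, J₀)(L_w)` of ★
`exists_frame_of_eq_smul_formCongr_antidiagonal` (its three clauses re-exported: `e g = A g_w A⁻¹`, `g ∈ K′ ⟺ e g ∈ GL₃(𝒪_w)`, matching ⟺ conjugacy with `ι((γ_H)_w)`)
and FOUR ELEMENTS `t b₀ b₁ ∈ G′_v` with: the LITERAL `e(t_b) = P_b · diag(x) · P_b⁻¹` and its EIGENFRAME `e(t_b) · P_b = P_b · diag(x)`; the CHARACTERISTIC POLYNOMIAL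
`χ_{t_b, w} = ∏ (X − xᵢ)` (⇒ deepness ∕ regularity downstream); LEVEL `t_b ∈ K′`; MATCHING: every `X ∈ GL₃(L_w)` with an eigenframe for `diag(x)` is conjugate to
`e(t_b)` — so `ι_v(γ_H) ↔ t_b` for every `γ_H` whose one-place image has such a frame (clause (iii)); and NON-CONJUGACY: `t_b ∼ t_b′` in `G′_v` forces `b = b′`
(§1 `forall_exists_norm_mul_of_conj_eq`: the slot ratios `ε^(bᵢ − b′ᵢ)`, `i = 0, 1`, must be norms).  The slot-`1` length `ε^b₁` (times the frame scalar `−det H′_w`)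
is the κ-sign slot of [Rogawski1990, (4.3.2)]. [cite: Rogawski1990, §3.5 Prop. 3.5.2 pp. 29–30; §3.6 p. 31; §4.9 p. 54; §14.2 p. 233] [cite: Flicker1998UnitaryFL, §2 Prop. 3 pp. 78–79]
[cite: Jacobowitz1962, §8] -/
theorem forall_ramified_representatives_of_frames (w : PlacesOver L v) (hw : IsCMField.complexConj L • w.1 = w.1)
    (hH'w : IsUnit (placeForm H' w.1))
    (A : GL (Fin 3) (w.1.adicCompletion L)) (hA : A ∈ glInt 3 (w.1.adicCompletion L))
    (hframe : placeForm H' w.1 = (-(placeForm H' w.1).det) •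
      formCongr (galAdicCompletionMap (L := L) (IsCMField.complexConj L) hw) A ((StdForm.antidiagonal 3).over (w.1.adicCompletion L)))
    {ε : w.1.adicCompletion L} (hεN : ¬ ∃ t : w.1.adicCompletion L, t * galAdicCompletionMap (L := L) (IsCMField.complexConj L) hw t = ε)
    {P : Fin 2 → Fin 2 → GL (Fin 3) (w.1.adicCompletion L)} (hPint : ∀ b₀ b₁, P b₀ b₁ ∈ glInt 3 (w.1.adicCompletion L))
    (hPD : ∀ b₀ b₁, formCongr (galAdicCompletionMap (L := L) (IsCMField.complexConj L) hw) (P b₀ b₁) ((StdForm.antidiagonal 3).over (w.1.adicCompletion L)) =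
      diagonal ![ε ^ (b₀ : ℕ), ε ^ (b₁ : ℕ), -(ε ^ ((b₀ : ℕ) + (b₁ : ℕ)))])
    {x : Fin 3 → w.1.adicCompletion L} (hx : Function.Injective x)
    (hx1 : ∀ i, galAdicCompletionMap (L := L) (IsCMField.complexConj L) hw (x i) * x i = 1) :
    ∃ (e : ↥(UnitaryGroup.«local» L (IsCMField.complexConj L) 3 H' v) ≃ₜ*
        ↥(unitaryGroupOfForm (galAdicCompletionMap (L := L) (IsCMField.complexConj L) hw)
          (placeForm (Matrix.of fun i j : Fin 3 => if i.val + j.val + 1 = 3 then (1 : L) else 0) w.1)))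
      (t : Fin 2 → Fin 2 → ↥(UnitaryGroup.«local» L (IsCMField.complexConj L) 3 H' v)),
      (∀ g, ((e g).val : GL (Fin 3) (w.1.adicCompletion L)) =
        A * ((localNonsplitEquiv (IsCMField.complexConj L) H' (IsCMField.complexConj_ne_one L) w hw g).val :
          GL (Fin 3) (w.1.adicCompletion L)) * A⁻¹) ∧
      (∀ g, g ∈ cmLocalIntegralLevel L 3 H' v ↔ ((e g).val : GL (Fin 3) (w.1.adicCompletion L)) ∈ glInt 3 (w.1.adicCompletion L)) ∧
      (∀ γH b, IsLocalNormPair L H' v γH b ↔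
        IsConj
          (endoGL
            (((localNonsplitEquiv (IsCMField.complexConj L)
                (Matrix.of fun i j : Fin 2 => if i.val + j.val + 1 = 2 then (1 : L) else 0) (IsCMField.complexConj_ne_one L) w hw γH.1).val :
                GL (Fin 2) (w.1.adicCompletion L)),
              ((localNonsplitEquiv (IsCMField.complexConj L)
                (Matrix.of fun i j : Fin 1 => if i.val + j.val + 1 = 1 then (1 : L) else 0) (IsCMField.complexConj_ne_one L) w hw γH.2).val :
                GL (Fin 1) (w.1.adicCompletion L))))
          ((e b).val : GL (Fin 3) (w.1.adicCompletion L))) ∧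
      -- the four representatives
      ∀ b₀ b₁,
        -- literal and eigenframe
        (((e (t b₀ b₁)).val : GL (Fin 3) (w.1.adicCompletion L)) : Matrix (Fin 3) (Fin 3) (w.1.adicCompletion L)) =
          (P b₀ b₁).val * diagonal x * ((P b₀ b₁)⁻¹).val ∧
        (((e (t b₀ b₁)).val : GL (Fin 3) (w.1.adicCompletion L)) : Matrix (Fin 3) (Fin 3) (w.1.adicCompletion L)) * (P b₀ b₁).val =
          (P b₀ b₁).val * diagonal x ∧
        -- characteristic polynomial at `w`
        ((((t b₀ b₁ : ↥(UnitaryGroup.«local» L (IsCMField.complexConj L) 3 H' v)) : GL (Fin 3) (LocalRing L v)) :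
            Matrix (Fin 3) (Fin 3) (LocalRing L v)).map (Pi.evalRingHom (fun w' : PlacesOver L v => w'.1.adicCompletion L) w)).charpoly =
          (Polynomial.X - Polynomial.C (x 0)) * (Polynomial.X - Polynomial.C (x 1)) * (Polynomial.X - Polynomial.C (x 2)) ∧
        -- level
        t b₀ b₁ ∈ cmLocalIntegralLevel L 3 H' v ∧
        -- matching with every `X` framed for `diag(x)`
        (∀ X Q : GL (Fin 3) (w.1.adicCompletion L), X.val * Q.val = Q.val * diagonal x →
          IsConj X ((e (t b₀ b₁)).val : GL (Fin 3) (w.1.adicCompletion L))) ∧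
        -- pairwise non-conjugacy
        (∀ b₀' b₁', IsConj (t b₀ b₁) (t b₀' b₁') → b₀ = b₀' ∧ b₁ = b₁') := by
  have hc := IsCMField.complexConj_ne_one L
  obtain ⟨e, he, hK, hmatch⟩ := exists_frame_of_eq_smul_formCongr_antidiagonal L H' w hw hH'w A hA hframe
  -- the diagonal torus element `d = diag(x)` as an element of `GL₃(L_w)` (kept opaque), integral
  obtain ⟨d, hd, hdinv⟩ : ∃ d : GL (Fin 3) (w.1.adicCompletion L), d.val = diagonal x ∧
      (d⁻¹).val = diagonal fun i => galAdicCompletionMap (L := L) (IsCMField.complexConj L) hw (x i) := by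
    refine ⟨glDiagonal 3 (w.1.adicCompletion L) fun i =>
      Units.mkOfMulEqOne (x i) (galAdicCompletionMap (L := L) (IsCMField.complexConj L) hw (x i)) (by rw [mul_comm]; exact hx1 i), ?_, ?_⟩
    · exact coe_glDiagonal 3 (w.1.adicCompletion L) _
    · rw [← map_inv]
      exact coe_glDiagonal 3 (w.1.adicCompletion L) _
  have hxv : ∀ i, ValuativeRel.valuation (w.1.adicCompletion L) (x i) = 1 := fun i =>
    valuation_eq_one_of_galAdicCompletionMap_mul_self_eq_one L w hw (hx1 i)
  have hσxv : ∀ i, ValuativeRel.valuation (w.1.adicCompletion L) (galAdicCompletionMap (L := L) (IsCMField.complexConj L) hw (x i)) = 1 := fun i => by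
    rw [valuation_galAdicCompletionMap_eq (IsCMField.complexConj L) v w hw, hxv i]
  have hdint : d ∈ glInt 3 (w.1.adicCompletion L) := by
    rw [mem_glInt_iff]
    refine ⟨fun i j => ?_, fun i j => ?_⟩
    · rw [show (d : Matrix (Fin 3) (Fin 3) (w.1.adicCompletion L)) = diagonal x from hd]
      by_cases hij : i = j
      · subst hij; rw [diagonal_apply_eq, Valuation.mem_integer_iff, hxv i]
      · rw [diagonal_apply_ne _ hij]; exact Subring.zero_mem _
    · rw [show ((d⁻¹ : GL (Fin 3) (w.1.adicCompletion L)) : Matrix (Fin 3) (Fin 3) (w.1.adicCompletion L)) = _ from hdinv]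
      by_cases hij : i = j
      · subst hij; rw [diagonal_apply_eq, Valuation.mem_integer_iff, hσxv i]
      · rw [diagonal_apply_ne _ hij]; exact Subring.zero_mem _
  -- the literals `τ_b = P_b d P_b⁻¹ ∈ U(σ_w, J₀)(L_w)`
  have hJ : placeForm (Matrix.of fun i j : Fin 3 => if i.val + j.val + 1 = 3 then (1 : L) else 0) w.1 =
      (StdForm.antidiagonal 3).over (w.1.adicCompletion L) := placeForm_antidiagOne 3 w.1
  have hPD' : ∀ b₀ b₁, formCongr (galAdicCompletionMap (L := L) (IsCMField.complexConj L) hw) (P b₀ b₁)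
      (placeForm (Matrix.of fun i j : Fin 3 => if i.val + j.val + 1 = 3 then (1 : L) else 0) w.1) =
      diagonal ![ε ^ (b₀ : ℕ), ε ^ (b₁ : ℕ), -(ε ^ ((b₀ : ℕ) + (b₁ : ℕ)))] := fun b₀ b₁ => by
    rw [hJ]; exact hPD b₀ b₁
  have hτmem : ∀ b₀ b₁, P b₀ b₁ * d * (P b₀ b₁)⁻¹ ∈ unitaryGroupOfForm (galAdicCompletionMap (L := L) (IsCMField.complexConj L) hw)
      (placeForm (Matrix.of fun i j : Fin 3 => if i.val + j.val + 1 = 3 then (1 : L) else 0) w.1) := fun b₀ b₁ =>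
    conj_diagonal_mem_unitaryGroupOfForm_of_formCongr_eq_diagonal _ (hPD' b₀ b₁) hd hx1
  -- the representatives
  refine ⟨e, fun b₀ b₁ => e.symm ⟨P b₀ b₁ * d * (P b₀ b₁)⁻¹, hτmem b₀ b₁⟩, he, hK, hmatch, fun b₀ b₁ => ?_⟩
  have het : e (e.symm ⟨P b₀ b₁ * d * (P b₀ b₁)⁻¹, hτmem b₀ b₁⟩) = ⟨P b₀ b₁ * d * (P b₀ b₁)⁻¹, hτmem b₀ b₁⟩ := e.apply_symm_apply _
  have hetv : ((e (e.symm ⟨P b₀ b₁ * d * (P b₀ b₁)⁻¹, hτmem b₀ b₁⟩)).val : GL (Fin 3) (w.1.adicCompletion L)) = P b₀ b₁ * d * (P b₀ b₁)⁻¹ :=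
    congrArg Subtype.val het
  dsimp only
  refine ⟨?_, ?_, ?_, ?_, ?_, ?_⟩
  · -- literal
    rw [hetv, Units.val_mul, Units.val_mul, hd]
  · -- eigenframe
    rw [hetv]; exact conj_diagonal_mul_frame hd
  · -- charpoly at `w`: the one-place matrix is `A⁻¹ (P d P⁻¹) A`
    have hw' := (coe_localNonsplitEquiv_apply L H' v w hw (e.symm ⟨P b₀ b₁ * d * (P b₀ b₁)⁻¹, hτmem b₀ b₁⟩)).symm
    have hloc : ((localNonsplitEquiv (IsCMField.complexConj L) H' hc w hw (e.symm ⟨P b₀ b₁ * d * (P b₀ b₁)⁻¹, hτmem b₀ b₁⟩)).val :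
          GL (Fin 3) (w.1.adicCompletion L)) = A⁻¹ * (P b₀ b₁ * d * (P b₀ b₁)⁻¹) * A := by
      have h1 := he (e.symm ⟨P b₀ b₁ * d * (P b₀ b₁)⁻¹, hτmem b₀ b₁⟩)
      rw [hetv] at h1
      calc ((localNonsplitEquiv (IsCMField.complexConj L) H' hc w hw (e.symm ⟨P b₀ b₁ * d * (P b₀ b₁)⁻¹, hτmem b₀ b₁⟩)).val :
              GL (Fin 3) (w.1.adicCompletion L))
          = A⁻¹ * (A * ((localNonsplitEquiv (IsCMField.complexConj L) H' hc w hw (e.symm ⟨P b₀ b₁ * d * (P b₀ b₁)⁻¹, hτmem b₀ b₁⟩)).val :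
              GL (Fin 3) (w.1.adicCompletion L)) * A⁻¹) * A := by group
        _ = A⁻¹ * (P b₀ b₁ * d * (P b₀ b₁)⁻¹) * A := by rw [← h1]
    have hval : (((localNonsplitEquiv (IsCMField.complexConj L) H' hc w hw (e.symm ⟨P b₀ b₁ * d * (P b₀ b₁)⁻¹, hτmem b₀ b₁⟩)).val :
          GL (Fin 3) (w.1.adicCompletion L)) : Matrix (Fin 3) (Fin 3) (w.1.adicCompletion L)) =
        (A⁻¹).val * ((P b₀ b₁).val * diagonal x * ((P b₀ b₁)⁻¹).val) * A.val := by
      rw [hloc, Units.val_mul, Units.val_mul, Units.val_mul, Units.val_mul, hd]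
    rw [hw', hval, Matrix.coe_units_inv A, Matrix.coe_units_inv (P b₀ b₁), Matrix.charpoly_units_conj', Matrix.charpoly_units_conj,
      Matrix.charpoly_diagonal, Fin.prod_univ_three]
  · -- level
    refine (hK _).2 ?_
    rw [hetv]
    exact Subgroup.mul_mem _ (Subgroup.mul_mem _ (hPint b₀ b₁) hdint) (Subgroup.inv_mem _ (hPint b₀ b₁))
  · -- matching
    intro X Q hXQ
    rw [hetv]
    exact isConj_conj_diagonal_of_frame hXQ hd
  · -- non-conjugacy
    intro b₀' b₁' hconj
    have h1 : IsConj (e (e.symm ⟨P b₀ b₁ * d * (P b₀ b₁)⁻¹, hτmem b₀ b₁⟩)) (e (e.symm ⟨P b₀' b₁' * d * (P b₀' b₁')⁻¹, hτmem b₀' b₁'⟩)) :=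
      MonoidHom.map_isConj e.toMonoidHom hconj
    rw [e.apply_symm_apply, e.apply_symm_apply] at h1
    obtain ⟨k, hk⟩ := isConj_iff.1 h1
    have hkv : (k.val : GL (Fin 3) (w.1.adicCompletion L)) * (P b₀ b₁ * d * (P b₀ b₁)⁻¹) * (k.val)⁻¹ = P b₀' b₁' * d * (P b₀' b₁')⁻¹ := by
      have h := congrArg Subtype.val hk
      simpa using h
    have hN := forall_exists_norm_mul_of_conj_eq _ (hPD' b₀ b₁) (hPD' b₀' b₁') hd hx k.2 hkv
    -- `ε` is not a norm, `1` is: the exponent pattern decides `b = b′` slot by slot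
    have hε0 : ε ≠ 0 := fun h => hεN ⟨0, by rw [h, zero_mul]⟩
    have key10 : ∀ m : w.1.adicCompletion L, ¬ ε ^ (1 : ℕ) = galAdicCompletionMap (L := L) (IsCMField.complexConj L) hw m * m * ε ^ (0 : ℕ) := by
      intro m hm
      rw [pow_one, pow_zero, mul_one] at hm
      exact hεN ⟨m, by rw [mul_comm]; exact hm.symm⟩
    have key01 : ∀ m : w.1.adicCompletion L, m ≠ 0 →
        ¬ ε ^ (0 : ℕ) = galAdicCompletionMap (L := L) (IsCMField.complexConj L) hw m * m * ε ^ (1 : ℕ) := by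
      intro m hm0 hm
      rw [pow_one, pow_zero] at hm
      refine hεN ⟨m⁻¹, ?_⟩
      rw [map_inv₀, ← _root_.mul_inv_rev, ← eq_inv_of_mul_eq_one_right hm.symm]
    have key : ∀ c c' : Fin 2, (∃ m : w.1.adicCompletion L, m ≠ 0 ∧
        ε ^ (c : ℕ) = galAdicCompletionMap (L := L) (IsCMField.complexConj L) hw m * m * ε ^ (c' : ℕ)) → c = c' := by
      intro c c' hm
      obtain ⟨m, hm0, hm⟩ := hm
      have hc : (c : ℕ) = 0 ∨ (c : ℕ) = 1 := by have := c.isLt; omega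
      have hc' : (c' : ℕ) = 0 ∨ (c' : ℕ) = 1 := by have := c'.isLt; omega
      apply Fin.ext
      rcases hc with hc | hc <;> rcases hc' with hc' | hc'
      · omega
      · rw [hc, hc'] at hm; exact absurd hm (key01 m hm0)
      · rw [hc, hc'] at hm; exact absurd hm (key10 m)
      · omega
    exact ⟨key b₀ b₀' (hN 0), key b₁ b₁' (hN 1)⟩

/-! ## §3 The package at a TAME-RAMIFIED place: `ε` from ★ p846845, the integral isometries from ★ p846940 -/

/-- **THE FOUR MATCHED REPRESENTATIVES AT A TAME-RAMIFIED PLACE** (row «P-1-ram (i) (N1)»; the ramified twin of ★ `exists_four_matched_flicker_representatives`).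
`v ∤ 2` a finite place of `L⁺`, `w ∣ v` non-split and RAMIFIED (`e(w|v) ≠ 1`, `|2|_w = 1`), `H′_w` framed by the fold's binders `(hH′w) (A hA hframe)`.  For every torus datum
`x : Fin 3 → L_w` (pairwise distinct, `σ_w(xᵢ) xᵢ = 1`) there are: a `σ_w`-fixed unit `ε` which is NOT a norm (★ `exists_fixed_unit_norm_dichotomy_of_ramified_complexConj`), the
one-place frame `e` (★ p846897, clauses (i)–(iii)), integral isometries `P b₀ b₁ ∈ GL₃(𝒪_w)` with `ᵗσ̄_w(P_b) J₀ P_b = diag(ε^b₀, ε^b₁, −ε^(b₀+b₁))` (★ p846940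
`exists_glInt_formCongr_antidiagonal_eq_diagonal_units_adicCompletion`), and four elements `t b₀ b₁ ∈ G′_v` with the literal ∕ eigenframe ∕ characteristic-polynomial ∕
level ∕ matching ∕ pairwise-non-conjugacy clauses of `forall_ramified_representatives_of_frames`.  By ★ `ncard_conjClassesIn_eq_four` these are ALL the classes matched
with a `G`-regular type-(1) `γ_H`; the slot-`1` length `ε^b₁` decides the κ-sign [Rogawski1990, (4.3.2)].
[cite: Rogawski1990, §3.5 Prop. 3.5.2 pp. 29–30; §3.6 p. 31; §4.3 (4.3.2) p. 43; §4.9 p. 54] [cite: Flicker1998UnitaryFL, §2 Prop. 3 pp. 78–79] [cite: Jacobowitz1962, §8]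
[cite: LabesseLanglands1979, §2 pp. 8–9] -/
theorem exists_four_ramified_representatives (w : PlacesOver L v) (hw : IsCMField.complexConj L • w.1 = w.1)
    (he : v.asIdeal.ramificationIdx' w.1.asIdeal ≠ 1) (h2 : Valued.v (2 : w.1.adicCompletion L) = 1)
    (hH'w : IsUnit (placeForm H' w.1))
    (A : GL (Fin 3) (w.1.adicCompletion L)) (hA : A ∈ glInt 3 (w.1.adicCompletion L))
    (hframe : placeForm H' w.1 = (-(placeForm H' w.1).det) •
      formCongr (galAdicCompletionMap (L := L) (IsCMField.complexConj L) hw) A ((StdForm.antidiagonal 3).over (w.1.adicCompletion L)))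
    {x : Fin 3 → w.1.adicCompletion L} (hx : Function.Injective x)
    (hx1 : ∀ i, galAdicCompletionMap (L := L) (IsCMField.complexConj L) hw (x i) * x i = 1) :
    ∃ (ε : w.1.adicCompletion L)
      (e : ↥(UnitaryGroup.«local» L (IsCMField.complexConj L) 3 H' v) ≃ₜ*
        ↥(unitaryGroupOfForm (galAdicCompletionMap (L := L) (IsCMField.complexConj L) hw)
          (placeForm (Matrix.of fun i j : Fin 3 => if i.val + j.val + 1 = 3 then (1 : L) else 0) w.1)))
      (P : Fin 2 → Fin 2 → GL (Fin 3) (w.1.adicCompletion L))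
      (t : Fin 2 → Fin 2 → ↥(UnitaryGroup.«local» L (IsCMField.complexConj L) 3 H' v)),
      galAdicCompletionMap (L := L) (IsCMField.complexConj L) hw ε = ε ∧ Valued.v ε = 1 ∧
      (¬ ∃ s : w.1.adicCompletion L, s * galAdicCompletionMap (L := L) (IsCMField.complexConj L) hw s = ε) ∧
      (∀ g, ((e g).val : GL (Fin 3) (w.1.adicCompletion L)) =
        A * ((localNonsplitEquiv (IsCMField.complexConj L) H' (IsCMField.complexConj_ne_one L) w hw g).val :
          GL (Fin 3) (w.1.adicCompletion L)) * A⁻¹) ∧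
      (∀ g, g ∈ cmLocalIntegralLevel L 3 H' v ↔ ((e g).val : GL (Fin 3) (w.1.adicCompletion L)) ∈ glInt 3 (w.1.adicCompletion L)) ∧
      (∀ γH b, IsLocalNormPair L H' v γH b ↔
        IsConj
          (endoGL
            (((localNonsplitEquiv (IsCMField.complexConj L)
                (Matrix.of fun i j : Fin 2 => if i.val + j.val + 1 = 2 then (1 : L) else 0) (IsCMField.complexConj_ne_one L) w hw γH.1).val :
                GL (Fin 2) (w.1.adicCompletion L)),
              ((localNonsplitEquiv (IsCMField.complexConj L)
                (Matrix.of fun i j : Fin 1 => if i.val + j.val + 1 = 1 then (1 : L) else 0) (IsCMField.complexConj_ne_one L) w hw γH.2).val :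
                GL (Fin 1) (w.1.adicCompletion L))))
          ((e b).val : GL (Fin 3) (w.1.adicCompletion L))) ∧
      -- the four representatives
      ∀ b₀ b₁,
        P b₀ b₁ ∈ glInt 3 (w.1.adicCompletion L) ∧
        formCongr (galAdicCompletionMap (L := L) (IsCMField.complexConj L) hw) (P b₀ b₁) ((StdForm.antidiagonal 3).over (w.1.adicCompletion L)) =
          diagonal ![ε ^ (b₀ : ℕ), ε ^ (b₁ : ℕ), -(ε ^ ((b₀ : ℕ) + (b₁ : ℕ)))] ∧
        -- literal and eigenframe
        (((e (t b₀ b₁)).val : GL (Fin 3) (w.1.adicCompletion L)) : Matrix (Fin 3) (Fin 3) (w.1.adicCompletion L)) =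
          (P b₀ b₁).val * diagonal x * ((P b₀ b₁)⁻¹).val ∧
        (((e (t b₀ b₁)).val : GL (Fin 3) (w.1.adicCompletion L)) : Matrix (Fin 3) (Fin 3) (w.1.adicCompletion L)) * (P b₀ b₁).val =
          (P b₀ b₁).val * diagonal x ∧
        -- characteristic polynomial at `w`
        ((((t b₀ b₁ : ↥(UnitaryGroup.«local» L (IsCMField.complexConj L) 3 H' v)) : GL (Fin 3) (LocalRing L v)) :
            Matrix (Fin 3) (Fin 3) (LocalRing L v)).map (Pi.evalRingHom (fun w' : PlacesOver L v => w'.1.adicCompletion L) w)).charpoly =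
          (Polynomial.X - Polynomial.C (x 0)) * (Polynomial.X - Polynomial.C (x 1)) * (Polynomial.X - Polynomial.C (x 2)) ∧
        -- level
        t b₀ b₁ ∈ cmLocalIntegralLevel L 3 H' v ∧
        -- matching with every `X` framed for `diag(x)`
        (∀ X Q : GL (Fin 3) (w.1.adicCompletion L), X.val * Q.val = Q.val * diagonal x →
          IsConj X ((e (t b₀ b₁)).val : GL (Fin 3) (w.1.adicCompletion L))) ∧
        -- pairwise non-conjugacy
        (∀ b₀' b₁', IsConj (t b₀ b₁) (t b₀' b₁') → b₀ = b₀' ∧ b₁ = b₁') := by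
  obtain ⟨ε, hσε, hεv, -, hεN, -⟩ := exists_fixed_unit_norm_dichotomy_of_ramified_complexConj L w hw he h2
  -- the integral isometries, one per `b`
  have hP : ∀ b : Fin 2 × Fin 2, ∃ P : GL (Fin 3) (w.1.adicCompletion L), P ∈ glInt 3 (w.1.adicCompletion L) ∧
      formCongr (galAdicCompletionMap (L := L) (IsCMField.complexConj L) hw) P ((StdForm.antidiagonal 3).over (w.1.adicCompletion L)) =
        diagonal ![ε ^ (b.1 : ℕ), ε ^ (b.2 : ℕ), -(ε ^ ((b.1 : ℕ) + (b.2 : ℕ)))] := fun b =>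
    exists_glInt_formCongr_antidiagonal_eq_diagonal_units_adicCompletion L w hw he h2 ε hσε hεv b.1 b.2
  choose Pf hPf using hP
  obtain ⟨e, t, he', hK, hmatch, ht⟩ := forall_ramified_representatives_of_frames L H' w hw hH'w A hA hframe hεN
    (P := fun b₀ b₁ => Pf (b₀, b₁)) (fun b₀ b₁ => (hPf (b₀, b₁)).1) (fun b₀ b₁ => (hPf (b₀, b₁)).2) hx hx1
  exact ⟨ε, e, fun b₀ b₁ => Pf (b₀, b₁), t, hσε, hεv, hεN, he', hK, hmatch, fun b₀ b₁ =>
    ⟨(hPf (b₀, b₁)).1, (hPf (b₀, b₁)).2, ht b₀ b₁⟩⟩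

end CM

end Literature.NumberTheory.Rogawski1990

end
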